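import Summits.QuantumFields.YangMills.Theorems.FlatTubeReductionProfileVolumeGrowthSlow
import Summits.QuantumFields.YangMills.Theorems.FlatTubeReductionReferenceMassBounds
import HarnessLib

/-!
# ASSEMBLED: the Gaussian tail of the diagonal density AT A SLOW DATUM `w`, absolute form — `∫_{β·kinDefect_w > T′} fpTriple(w,w)/K₁(w,w) dμP ≤ e^{βE(τ,σ)}·e^{−T′/2}·5e^{1/2}4^{3n}(3n)!·V_w`
# (`V_w` of `profile_volume_growth_slow`; divide by `reference_mass_ge_floor/K₁(1,1)` to get the `η` of the core+tail sandwich at `u`)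
# (route `FlatTubeReduction`, crux K1 `NearFlatRatioLaw` stmt-QuantumFields-24720; seat `ym-line-ftr-p1` g12; rate twin «ratepack-v3 / frozen fibres»; R2b1 RECORD rung — no summit
# statement is proved here)

WHY (memo `Cruxes/NearFlatRatioLaw/Lines/ratepack-v3-frozen-g12.md` §5.11 (2)).  `ρ_w = fpTriple β Ω (fpWeight ε) w w / K₁(w,w) = F·σ_w` with the same weight `F = Ω·fpWeight·Ω` as at `w = 1` and
`σ_w ≤ e^{βE(τ,σ)}·e^{−β·kinDefect(oT w v, oT w v′, g)}` on the support of `F` (`…ReferenceDensityDomination.fpTriple_diag_div_le`; off the support we truncate `σ_w` by the bound, which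
changes nothing under `F`).  The weighted tail lemma with the slow volume growth gives the absolute tail; together with `…SlowCoreInclusion` (`{N > T} ⊆ {N_w > T′}` on the pinned
core) and the floor this is the `htailu` hypothesis of `fpBOKernel_diag_two_sided_moment_core`.
  ★★★ `slow_reference_tail_abs_le`.
HONEST FRAMING: assembly bookkeeping; femto rung R2b1 (RECORD label); not infinite volume, not a gap, not Clay.  No defs, no named facts, no `sorry`.
-/

set_option autoImplicit false

noncomputable section

open MeasureTheory Filter Topology Real Set
open scoped BigOperators ENNReal
open Literature.MathematicalPhysics.QuantumFieldTheory
open Literature.MathematicalPhysics.QuantumLattice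

namespace Summit.QuantumFields.YangMills.Theorems.FemtoTransferGap.RateTube

open Summit.QuantumFields.YangMills.Theorems.FemtoTransferGap
open Summit.QuantumFields.YangMills.Theorems.FemtoTransferGap.TwoLattice
open Summit.QuantumFields.YangMills.Theorems.FemtoTransferGap.TwoLattice.ConstTube
open Summit.QuantumFields.YangMills.Theorems.FemtoTransferGap.TwoLattice.Avg
open Summit.QuantumFields.YangMills.Theorems.FemtoTransferGap.TwoLattice.Cov
open Summit.QuantumFields.YangMills.Theorems.FemtoTransferGap.TwoLattice.Stiff (LinkSpace)

variable {L : ℕ} [NeZero L]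

set_option maxHeartbeats 800000 in
/-- ★★★ **The slow reference tail, absolute form.**  `β > 0`; a slow datum `w` with `‖q(w_k) − 1‖ ≤ τ_w` (`τ_w ≥ 0`) and `L³S₁(w) ≤ σ < 2`; a profile `Ω` (measurable, `0 ≤ Ω ≤ CΩ`) whose
support lies in the capped balanced set with `‖v̂‖ ≤ R` and `|v_{e,c}| ≤ τ ≤ 1/30`; `ε` any; `n = |Λ|−1`.  Then for every level `T′`,
`∫_{T′ < β·kinDefect(oT w v,oT w v′,g)} fpTriple β Ω (fpWeight ε) w w dμP / K₁(w,w) ≤ e^{β·E(τ,σ)}·(e^{−T′/2}·5e^{1/2}·4^{3n}·(3n)!·V_w)` with `V_w` the constant of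
`profile_volume_growth_slow`. [cite: Luscher1983, §3] -/
theorem slow_reference_tail_abs_le {β : ℝ} (hβ : 0 < β) (w : GaugeConfig 3 1 SU2) {τw : ℝ} (hτw0 : 0 ≤ τw) (hw : ∀ k : Fin 3, ‖su2Quat (w (0, k)) - 1‖ ≤ τw)
    {σ : ℝ} (hσ : σ < 2) (hS : (L : ℝ) ^ 3 * wilsonAction su2Rep w ≤ σ)
    {Ω : LinkSpace L → ℝ} (hΩm : Measurable Ω) {CΩ : ℝ} (hCΩ : ∀ x, |Ω x| ≤ CΩ) (hΩ0 : ∀ x, 0 ≤ Ω x) {R τ : ℝ} (hτ : τ ≤ 1 / 30)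
    (hΩt : ∀ v : Edge 3 L → Fin 3 → ℝ, Ω (linkEmbed L v) ≠ 0 → v ∈ capBalancedSet L ∧ ‖linkEmbed L v‖ ≤ R)
    (hΩτ : ∀ v : Edge 3 L → Fin 3 → ℝ, Ω (linkEmbed L v) ≠ 0 → ∀ (e : Edge 3 L) (c : Fin 3), |v e c| ≤ τ) (ε T' : ℝ) :
    (∫ p in {p : (Edge 3 L → Fin 3 → ℝ) × ((Edge 3 L → Fin 3 → ℝ) × (Site 3 L → SU2)) | T' < β * kinDefect L (orthoTube L w p.1) (orthoTube L w p.2.1) p.2.2},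
        fpTriple L β Ω (fpWeight L ε) w w p ∂((orthoTransverse L).prod ((orthoTransverse L).prod (gaugeMeasure L)))) / transferKernel su2Rep ((L : ℝ) ^ 3 * β) w w ≤
      Real.exp (β * stepActionErr (L := L) τ σ) *
        (Real.exp (-(T' / 2)) * (5 * Real.exp (1 / 2) * 4 ^ (3 * Fintype.card {x : Site 3 L // ¬x = 0}) * (3 * Fintype.card {x : Site 3 L // ¬x = 0}).factorial *
          (fpZ ε * ((π ^ 2 / 12) ^ Fintype.card {x : Site 3 L // ¬x = 0} * (3 * (L : ℝ)) ^ (3 * Fintype.card {x : Site 3 L // ¬x = 0}) *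
              3 ^ (3 * Fintype.card {x : Site 3 L // ¬x = 0}) * ((Real.sqrt β)⁻¹) ^ (3 * Fintype.card {x : Site 3 L // ¬x = 0})) *
            (3 ^ (3 * Fintype.card {x : Site 3 L // ¬x = 0}) * (1 + 2 * (Real.sqrt β * (3 * τw)) ^ (3 * Fintype.card {x : Site 3 L // ¬x = 0})) *
                (∫ v, Ω (linkEmbed L v) ∂orthoTransverse L) ^ 2 +
              ((5 * Real.sqrt 2) ^ (3 * Fintype.card {x : Site 3 L // ¬x = 0}) + Real.sqrt 2 ^ (3 * Fintype.card {x : Site 3 L // ¬x = 0})) *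
                (∫ v, Ω (linkEmbed L v) ∂orthoTransverse L) * ∫ v, Ω (linkEmbed L v) * (Real.sqrt β * ‖linkEmbed L v‖) ^ (3 * Fintype.card {x : Site 3 L // ¬x = 0}) ∂orthoTransverse L)))) := by
  haveI := isFiniteMeasure_orthoTransverse L
  haveI : SecondCountableTopology SU2 := secondCountableTopology_su2
  set n : ℕ := Fintype.card {x : Site 3 L // ¬x = 0} with hn
  set μP : Measure ((Edge 3 L → Fin 3 → ℝ) × ((Edge 3 L → Fin 3 → ℝ) × (Site 3 L → SU2))) := (orthoTransverse L).prod ((orthoTransverse L).prod (gaugeMeasure L)) with hμP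
  haveI : IsFiniteMeasure μP := by rw [hμP]; infer_instance
  set Kw : ℝ := transferKernel su2Rep ((L : ℝ) ^ 3 * β) w w with hKw
  have hKwp : 0 < Kw := transferKernel_pos _ _ _ _
  have hle : Measurable (linkEmbed L) := measurable_linkEmbed L
  have hfw : Measurable (fpWeight L ε) := measurable_fpWeight L ε
  have hCΩ0 : 0 ≤ CΩ := (abs_nonneg _).trans (hCΩ 0)
  set C₁ : ℝ := Real.exp (β * stepActionErr (L := L) τ σ) with hC₁
  have hC₁0 : 0 ≤ C₁ := (Real.exp_pos _).le
  -- weight, level, truncated kernel ratio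
  set F : (Edge 3 L → Fin 3 → ℝ) × ((Edge 3 L → Fin 3 → ℝ) × (Site 3 L → SU2)) → ℝ := fun p => Ω (linkEmbed L p.1) * (fpWeight L ε p.2.2 * Ω (linkEmbed L p.2.1)) with hF
  have hNm' := (continuous_kinDefect_joint (L := L)).measurable.comp
    (((measurable_orthoTube_right (L := L) w).comp measurable_fst).prodMk
      (((measurable_orthoTube_right (L := L) w).comp (measurable_fst.comp measurable_snd)).prodMk (measurable_snd.comp measurable_snd)))
  have hNm : Measurable fun p : (Edge 3 L → Fin 3 → ℝ) × ((Edge 3 L → Fin 3 → ℝ) × (Site 3 L → SU2)) => β * kinDefect L (orthoTube L w p.1) (orthoTube L w p.2.1) p.2.2 :=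
    hNm'.const_mul β
  have hN0 : ∀ p : (Edge 3 L → Fin 3 → ℝ) × ((Edge 3 L → Fin 3 → ℝ) × (Site 3 L → SU2)), 0 ≤ β * kinDefect L (orthoTube L w p.1) (orthoTube L w p.2.1) p.2.2 := fun p =>
    mul_nonneg hβ.le (kinDefect_nonneg _ _ _)
  set bnd : (Edge 3 L → Fin 3 → ℝ) × ((Edge 3 L → Fin 3 → ℝ) × (Site 3 L → SU2)) → ℝ := fun p =>
    C₁ * Real.exp (-(β * kinDefect L (orthoTube L w p.1) (orthoTube L w p.2.1) p.2.2)) with hbnd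
  set σw : (Edge 3 L → Fin 3 → ℝ) × ((Edge 3 L → Fin 3 → ℝ) × (Site 3 L → SU2)) → ℝ := fun p =>
    min (fpTriple L β (fun _ => (1 : ℝ)) (fun _ => (1 : ℝ)) w w p / Kw) (bnd p) with hσw
  have hbndm : Measurable bnd := (Real.measurable_exp.comp hNm.neg).const_mul C₁
  have hσwm : Measurable σw := ((measurable_fpTriple β measurable_const measurable_const w w).div_const _).min hbndm
  have hratio_eq : ∀ p, fpTriple L β (fun _ => (1 : ℝ)) (fun _ => (1 : ℝ)) w w p / Kw = transferKernel su2Rep β (orthoTube L w p.1) (gaugeTransform p.2.2 (orthoTube L w p.2.1)) / Kw :=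
    fun p => by unfold fpTriple; ring
  have hσw0 : ∀ p, 0 ≤ σw p := fun p => le_min (by rw [hratio_eq]; exact div_nonneg (transferKernel_pos _ _ _ _).le hKwp.le) (mul_nonneg hC₁0 (Real.exp_pos _).le)
  have hσwup : ∀ p, σw p ≤ C₁ * Real.exp (-(β * kinDefect L (orthoTube L w p.1) (orthoTube L w p.2.1) p.2.2)) := fun p => min_le_right _ _
  -- on the support of `F`, the truncation is inactive: `F·σw = fpTriple(w,w)/Kw`
  have hFσ : ∀ p, F p * σw p = fpTriple L β Ω (fpWeight L ε) w w p / Kw := by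
    rintro ⟨v, v', g⟩
    by_cases hz : Ω (linkEmbed L v) * Ω (linkEmbed L v') = 0
    · have hF0' : F (v, (v', g)) = 0 := by rw [hF]; dsimp only; rcases mul_eq_zero.mp hz with h | h <;> simp [h]
      have hρ0 : fpTriple L β Ω (fpWeight L ε) w w (v, (v', g)) = 0 := by unfold fpTriple; dsimp only; rcases mul_eq_zero.mp hz with h | h <;> simp [h]
      rw [hF0', hρ0, zero_mul, zero_div]
    · have hvne : Ω (linkEmbed L v) ≠ 0 := fun h => hz (by rw [h, zero_mul])
      have hv'ne : Ω (linkEmbed L v') ≠ 0 := fun h => hz (by rw [h, mul_zero])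
      have hk := fpTriple_diag_div_le (L := L) hβ.le (Ω := fun _ => (1 : ℝ)) (fun _ => zero_le_one) (W := fun _ => (1 : ℝ)) (fun _ => zero_le_one) w
        (hΩt v hvne).1 (hΩt v' hv'ne).1 hτ hσ hS (hΩτ v hvne) (hΩτ v' hv'ne) g
      have hmin : σw (v, (v', g)) = fpTriple L β (fun _ => (1 : ℝ)) (fun _ => (1 : ℝ)) w w (v, (v', g)) / Kw := by
        rw [hσw]; dsimp only; refine min_eq_left ?_
        rw [hbnd]; dsimp only; rw [hC₁, ← Real.exp_add]
        refine hk.trans (le_of_eq ?_)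
        simp only [one_mul, mul_one]; ring_nf
      rw [hmin, hF]; dsimp only; unfold fpTriple; dsimp only; ring
  -- the weight data
  have hFm : Measurable F := by
    have a1 : Measurable fun p : (Edge 3 L → Fin 3 → ℝ) × ((Edge 3 L → Fin 3 → ℝ) × (Site 3 L → SU2)) => Ω (linkEmbed L p.1) := hΩm.comp (hle.comp measurable_fst)
    have a2 : Measurable fun p : (Edge 3 L → Fin 3 → ℝ) × ((Edge 3 L → Fin 3 → ℝ) × (Site 3 L → SU2)) => fpWeight L ε p.2.2 := hfw.comp (measurable_snd.comp measurable_snd)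
    have a3 : Measurable fun p : (Edge 3 L → Fin 3 → ℝ) × ((Edge 3 L → Fin 3 → ℝ) × (Site 3 L → SU2)) => Ω (linkEmbed L p.2.1) :=
      hΩm.comp (hle.comp (measurable_fst.comp measurable_snd))
    exact a1.mul (a2.mul a3)
  have hF0 : ∀ p, 0 ≤ F p := fun p => mul_nonneg (hΩ0 _) (mul_nonneg (fpWeight_mem_Icc L ε _).1 (hΩ0 _))
  have hFb : ∀ p, F p ≤ CΩ * CΩ := fun p => by
    calc F p = Ω (linkEmbed L p.1) * (fpWeight L ε p.2.2 * Ω (linkEmbed L p.2.1)) := rfl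
      _ ≤ CΩ * (1 * CΩ) := mul_le_mul ((le_abs_self _).trans (hCΩ _)) (mul_le_mul (fpWeight_mem_Icc L ε _).2 ((le_abs_self _).trans (hCΩ _)) (hΩ0 _) zero_le_one)
            (mul_nonneg (fpWeight_mem_Icc L ε _).1 (hΩ0 _)) hCΩ0
      _ = CΩ * CΩ := by ring
  -- volume growth at `w`
  have hV : ∀ t : ℝ, 0 ≤ t → ∫ p in {p | β * kinDefect L (orthoTube L w p.1) (orthoTube L w p.2.1) p.2.2 ≤ t}, F p ∂μP ≤ _ * (t + 1) ^ (3 * n) := fun t ht => by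
    rw [hμP, hF]; exact profile_volume_growth_slow (L := L) hβ w hτw0 hw hΩm hCΩ hΩ0 hΩt ε ht
  -- the weighted tail
  have htail := setIntegral_weighted_tail_le μP hFm hF0 hFb hNm hN0 hV hσwm hσw0 hC₁0 hσwup T'
  -- convert `F·σw` back to `fpTriple(w,w)/Kw`
  have e1 : ∫ p in {p | T' < β * kinDefect L (orthoTube L w p.1) (orthoTube L w p.2.1) p.2.2}, F p * σw p ∂μP =
      (∫ p in {p | T' < β * kinDefect L (orthoTube L w p.1) (orthoTube L w p.2.1) p.2.2}, fpTriple L β Ω (fpWeight L ε) w w p ∂μP) / Kw := by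
    rw [← integral_div]; exact integral_congr_ae (ae_of_all _ fun p => hFσ p)
  rw [e1] at htail
  rw [hμP] at htail
  exact htail

end Summit.QuantumFields.YangMills.Theorems.FemtoTransferGap.RateTube

end
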